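import Summits.CriticalPhenomena.PercolationContinuityZ3.Theorems.PercNearOneGluingNoHeavyQuantLightResidDEC
import HarnessLib

/-!
# QUANT lane R8, T-DEC: THE PURE (LAW-LEVEL) FORM OF THE LIGHT NODE — `LightResidDECLaw`: for ARBITRARY top-affordable sub-forest laws (no tree
# structure, no oracle) the top-level residual is DEC at the capped floor at every layer; `LightResidDECLaw ⟹ LightResidDEC ⟹ FarTreeRow`
# (arm-1 gen 50, architect)

builds on p205010 (kernel theorem, internal audit signed; external expert review pending)

Statement + support file (`--supports stmt-CriticalPhenomena-4575`), QUANT lane seat prim-quant-arm-1 (gen 50, architect), rung R8 of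
`run/shared/lean/prim/quant/LADDER.md`; memo `run/shared/lean/prim/quant/prim-quant-arm-1-g50/ARCH-G50.md` §6.  One law-level binder
(`Sib.AffOK`, `SibFamAff₃`) and one `@[conjecture]` (`LightResidDECLaw`); theorems with standard axioms, no sorries.

WHY (ARCH-G50 §6).  The light node `LightResidDEC` (✓ p447494) quantifies over lists of tree-built composite siblings (`SibFam₃`: `Sib.TreeOK`).  Exact
census with ARBITRARY sub-forest laws — random masses on random atom sets, bimodal `{1, M}`, far dust `(1−ε)δ₁ + εδ_M`, two-level, zero atoms, blob
laws, one near-sure giant of top 40 beside small siblings; gates `.05–.999`; floor `x₁ := mean/M` (top-affordability with equality); `k = 2..5`;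
≈ 34 000 (forest, outer gate) pairs at the capped floor `min(a·x, 1/2)` — finds the residual DEC at every layer in EVERY case (per-layer exact LPs;
the layer-free certificate fails only at `k = 2` or extreme heterogeneity).  So the light node appears to be a property of the TILTED PRODUCT MIXTURE
and top-affordability ALONE; this file types that pure form, which is the statement a k-general proof should attack (the class of arbitrary laws is
closed under the list operations, unlike tree-built laws), and records that it implies the node:
* `Sib.AffOK x s` := `s.LawOK ∧ 0 < s.x₁ ∧ x ≤ s.q·s.x₁ ∧ s.x₁·s.M ≤ s.mean` (law-valid, affordable floor, compatible with the forest floor);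
  `Sib.TreeOK.affOK` (tree-OK data is aff-OK: top-affordability from `TreeBuiltN.lawFacts`); `SibFamAff₃`; `sibFamAff₃_of_sibFam₃`;
* **`@[conjecture] LightResidDECLaw := LightResidDECOn SibFamAff₃`**; **`lightResidDEC_of_law : LightResidDECLaw → LightResidDEC`**;
  **`Quant.farTreeRow_of_lightResidDECLaw`** (unconditional).

HONEST STATUS: `LightResidDECLaw` is EVIDENCE-LEVEL and STRONGER than `LightResidDEC`; a refuted sub-family lands as `¬ LightResidDECOn fam`.  All of
`LightResidDEC`, `LightSiblingStep`, `SiblingStep`, `FarTreeRow` OPEN.  RATE class log\* / honest sentence of `run/shared/lean/prim/quant/README.md`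
unchanged.  [this work].  Nothing here is cited as a published result.  The gluing rows served [cite: KozmaNitzan2024, Conjecture 3 (p. 15)];
product measure [cite: Grimmett1999, §1.3 p. 10].
-/

noncomputable section

open scoped BigOperators

namespace Summit.CriticalPhenomena.PercolationContinuityZ3.Theorems
namespace Quant
namespace LawDec

open Finset

/-- **law-level validity of sibling data at floor `x` with an affordable sub-floor**: `0 < q < 1` and `ρ` a probability law on `{0..M}` (`LawOK`),
a sub-floor `0 < x₁` compatible with the forest floor (`x ≤ q·x₁`) and top-affordable (`x₁·M ≤ mean ρ`).  No tree structure. [this work] -/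
def Sib.AffOK (x : ℝ) (s : Sib) : Prop :=
  s.LawOK ∧ 0 < s.x₁ ∧ x ≤ s.q * s.x₁ ∧ s.x₁ * (s.M : ℝ) ≤ s.mean

/-- tree-OK sibling data is aff-OK (top-affordability of a tree-built law, `TreeBuiltN.lawFacts`). [this work] -/
theorem Sib.TreeOK.affOK {x : ℝ} {s : Sib} (h : s.TreeOK x) : s.AffOK x := by
  obtain ⟨hq0, hq1, hxq, hT, _⟩ := h
  obtain ⟨hx₁0, _, ρ0, ρM, ρ1, ρta⟩ := hT.lawFacts
  exact ⟨⟨hq0, hq1, ρ0, ρM, ρ1⟩, hx₁0, hxq, ρta⟩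

/-- **the pure family**: lists of at least three aff-OK siblings at floor `x`. [this work] -/
def SibFamAff₃ (x : ℝ) (L : List Sib) : Prop :=
  (∀ s ∈ L, s.AffOK x) ∧ 3 ≤ L.length

/-- `SibFam₃ ⊆ SibFamAff₃`. [this work] -/
theorem sibFamAff₃_of_sibFam₃ {x : ℝ} {L : List Sib} (h : SibFam₃ x L) : SibFamAff₃ x L :=
  ⟨fun s hs => (h.1 s hs).affOK, h.2⟩

/-- **CONJECTURE `LIGHT RESID-DEC, PURE FORM` (arm-1 g50 ARCH-G50 §6).**  For every list of `k ≥ 3` siblings `(qᵢ, ρᵢ)` with `0 < qᵢ < 1`, `ρᵢ` ANY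
probability law on `{0..Mᵢ}` with a sub-floor `0 < x₁ᵢ`, `x₁ᵢ·Mᵢ ≤ mean ρᵢ`, at a forest floor `0 < x < 1` with `x ≤ qᵢ·x₁ᵢ`, and every outer gate
`0 < a < 1`: the top-level residual `resid a (wco a L) L` is DEC at the CAPPED floor `min (a·x) (1/2)` at every layer below `ftop L`
(`LightResidDECAt x a L`).  No tree structure, no SDEC oracle — a statement about the tilted product mixture alone.  KERNEL FACTS:
`LightResidDECLaw ⟹ LightResidDEC ⟹ LightSiblingStep ⟹ Quant.FarTreeRow`.  EVIDENCE (ARCH-G50 §6, exact per-layer LPs): ≈ 34 000 (forest, a) pairs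
with arbitrary laws (random / bimodal / far-dust / two-level / zero-atom / blob / near-sure-giant sub-forests, gates .05–.999, k = 2..5), 0 failures;
plus the ≈ 506 000 tree-built pairs of `LightResidDEC`.  The LAYER-FREE analogue is false at k = 2 and at extreme heterogeneity (per-layer only there).
builds on p205010 (kernel theorem, internal audit signed; external expert review pending). [this work] [status: open] -/
@[conjecture] def LightResidDECLaw : Prop :=
  LightResidDECOn SibFamAff₃

/-- **`LightResidDECLaw ⟹ LightResidDEC`** (the pure form implies the node: tree-OK lists are aff-OK). [this work] -/
theorem lightResidDEC_of_law (h : LightResidDECLaw) : LightResidDEC :=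
  LightResidDECOn.mono h fun _ _ hf => sibFamAff₃_of_sibFam₃ hf

end LawDec

/-- **`LightResidDECLaw ⟹ Quant.FarTreeRow`, UNCONDITIONALLY.** [this work] -/
theorem farTreeRow_of_lightResidDECLaw (h : LawDec.LightResidDECLaw) : FarTreeRow :=
  farTreeRow_of_lightResidDEC (LawDec.lightResidDEC_of_law h)

end Quant
end Summit.CriticalPhenomena.PercolationContinuityZ3.Theorems
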